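import Literature.Topology.FourManifolds.CollarFill
import Literature.Topology.FourManifolds.ExpHeightBall
import Literature.Topology.FourManifolds.RegularLevelSet
import HarnessLib

/-!
# The sub-sphere of the capped-ball step: decomposition, compactness, regularity, and its
# structure as a regular level

Topic `Literature/Topology/FourManifolds`; fact seat of Alexander's theorem
(`provefact-Literature.Topology.FourManifolds.SphereEmbedding.schoenflies_exists_ball`, Schultens
(2014), Thm. 3.2.5).  **Everything in this file is proved; no definitions, no named facts.**

The smoothed sphere `S₁` ("we isotope `S₁` … slightly … to be smooth", Schultens (2014), proof of
Thm. 3.2.5, PDF p. 45) of the fact seat's step is the set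
`W = subSphere F P E₁ s δ ε₀ = {x ∈ subDomain | G_B x = 0}` of `CappedBallData.lean`.  Under the
normal-form hypotheses `StepNF`, the scales `StepScale` and an admissible `P`, this file proves:

* §2 zone values: on the collar zone `F₂ = G` (`fillFun_eq_lidFun_of_collar`), inner/lateral
  signs, a priori bounds on zeros;
* §3 `CappedBallLid.subSphere_eq` — **`W` is the union of the lid piece `{G = 0, x₂ ≥ -3s}`, the
  low piece `{F₂ = 0, x₂ ≤ -5s/2} ∩ closedBox` and the far part `E₂ ∖ closedBox` of the absorbed
  disc**; in particular `W ⊆ (lid piece) ∪ {F₂ = 0}` (`mem_lidPiece_or_fillFun_eq_zero`);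
* §4 `CappedBallLid.isCompact_subSphere` — `W` is compact;
* §5 `CappedBallLid.subFun_eventuallyEq_lidFun`, `subFun_eventuallyEq_fillFun`,
  `fderiv_subFun_ne_zero_of_mem` — the germ of `G_B` along `W` is that of `G` or of `F₂`, and
  `G_B` is regular along `W`;
* §6 `CappedBallLid.isRegularLevel_subFun` — **`0` is a regular level of `G_B` on its (open)
  domain**, so that `W` carries the structure of a smooth surface (`RegularLevelSet.lean`:
  `RegularLevel`, charts, `isSmoothEmbedding_incl`), with `image_val_preimage_eq` identifying the
  level with `W`.

## References

* J. Schultens, *Introduction to 3-Manifolds*, GSM 151 (2014), proof of Thm. 3.2.5 (PDF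
  p. 45). [Schultens2014]
* M. W. Hirsch, *Differential Topology*, GTM 33 (1976), Ch. 1 §3, Thm. 3.2. [HirschDT1976]
-/

open scoped RealInnerProductSpace Topology Manifold ContDiff
open Set Filter Metric Function

noncomputable section

namespace Literature.Topology.FourManifolds

namespace CappedBallLid

variable {F : EuclideanSpace ℝ (Fin 3) → ℝ} {P : ℝ → ℝ} {E₁ E₂ : Set (EuclideanSpace ℝ (Fin 3))}
  {w₀ η₀ ε₀ s δ : ℝ}

/-! ### §1 The rim radius on the collar zone -/

/-- `λ(1/2) = 1/2` for Mathlib's smooth transition (by the symmetry `λ(x) + λ(1 - x) = 1`).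
[folklore] -/
theorem smoothTransition_one_half : Real.smoothTransition (1 / 2) = 1 / 2 := by
  unfold Real.smoothTransition
  have h : (1 : ℝ) - 1 / 2 = 1 / 2 := by norm_num
  rw [h]
  have he : 0 < expNegInvGlue (1 / 2 : ℝ) := expNegInvGlue.pos_of_pos (by norm_num)
  field_simp
  ring

/-- On `z ≥ -3s` the rim radius is at least `s/2`. [folklore] -/
theorem half_le_rimRadius (hs : 0 < s) {z : ℝ} (hz : -3 * s ≤ z) : s / 2 ≤ rimRadius s z := by
  unfold rimRadius
  have h : (1 : ℝ) / 2 ≤ (z + 4 * s) / (2 * s) := by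
    rw [le_div_iff₀ (by linarith)]; linarith
  have := Real.smoothTransition.monotone h
  rw [smoothTransition_one_half] at this
  nlinarith

/-! ### §2 Zone values: where the filled function is the lid function, and signs -/

section Zones

/-- Numerical consequences of the scales, collected. [folklore] -/
theorem scales (hS : StepScale s δ w₀ η₀) : 0 < s ∧ s ≤ 1 / 8 ∧ 8 * s ≤ w₀ ∧ 20 * s ≤ η₀ ∧ 0 < δ ∧ δ ≤ s / 16 :=
  ⟨hS.hs, hS.hs1, hS.hsw, hS.hsη, hS.hδ, hS.hδs⟩

/-- In the box `{ρ² ≤ (1+3s)², |x₂| ≤ 6s}` the defining function is `ρ² - 1`. [folklore] -/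
theorem F_eq_of_box (hN : StepNF F E₁ E₂ w₀ η₀ ε₀) (hS : StepScale s δ w₀ η₀) {x : EuclideanSpace ℝ (Fin 3)} (h1 : hsq x ≤ (1 + 3 * s) ^ 2)
    (h2 : |x 2| ≤ 6 * s) : F x = hsq x - 1 := by
  obtain ⟨hs, hs1, hsw, hsη, -, -⟩ := scales hS
  exact hN.hNF x (by nlinarith) (by linarith)

/-- **On the collar zone the filled function is the lid function**: for
`1 - s/4 ≤ ρ² ≤ (1+2s)²`, `-3s ≤ x₂ ≤ -2s`, `F₂ = G` (there `w - 1 = G` and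
`F - G ≥ min(F - a, F - b) - κ ≥ s - s/8 ≥ δ`, as `F - b = 2r + r² ≥ s` and
`F - a = (ρ² - 1)(1 - s) - x₂ ≥ 2s - s/4`). [folklore] -/
theorem fillFun_eq_lidFun_of_collar (hP : Admissible P) (hN : StepNF F E₁ E₂ w₀ η₀ ε₀) (hS : StepScale s δ w₀ η₀) {x : EuclideanSpace ℝ (Fin 3)} (h1 : 1 - s / 4 ≤ hsq x)
    (h2 : hsq x ≤ (1 + 2 * s) ^ 2) (h3 : -3 * s ≤ x 2) (h4 : x 2 ≤ -2 * s) :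
    fillFun F P s δ ((1 + s) ^ 2 + ε₀ + 2) x = lidFun P s x := by
  obtain ⟨hs, hs1, hsw, hsη, hδ, hδs⟩ := scales hS
  have hw : fillWeight P s δ ((1 + s) ^ 2 + ε₀ + 2) x = 1 + lidFun P s x :=
    fillWeight_eq_of_mem_box hs h2 h3 (by linarith)
  have hF : F x = hsq x - 1 := F_eq_of_box hN hS (by nlinarith) (abs_le.2 ⟨by linarith, by linarith⟩)
  have hG := lidFun_le_max_add hP.hPle hs x
  have hr := half_le_rimRadius hs h3
  have hr1 := rimRadius_le hs (x 2)
  have ha : F x - topFun s x ≥ s := by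
    rw [hF]; unfold topFun; nlinarith
  have hb : F x - rimFun s x ≥ s := by
    rw [hF]; unfold rimFun; nlinarith
  have hmax : max (topFun s x) (rimFun s x) ≤ F x - s := max_le (by linarith) (by linarith)
  rw [show lidFun P s x = fillWeight P s δ ((1 + s) ^ 2 + ε₀ + 2) x - 1 by rw [hw]; ring]
  exact fillFun_eq_right hP.hP1 hδ (by rw [hw]; linarith)

/-- On the inner zone `ρ² ≤ 1 - s/4`, `-3s ≤ x₂ ≤ -2s`, both the lid function and the filled
function are negative. [folklore] -/
theorem neg_of_inner (hP : Admissible P) (hS : StepScale s δ w₀ η₀) {x : EuclideanSpace ℝ (Fin 3)} (h1 : hsq x ≤ 1 - s / 4)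
    (h3 : -3 * s ≤ x 2) (h4 : x 2 ≤ -2 * s) :
    lidFun P s x < 0 ∧ fillFun F P s δ ((1 + s) ^ 2 + ε₀ + 2) x < 0 := by
  obtain ⟨hs, hs1, hsw, hsη, hδ, hδs⟩ := scales hS
  have hG := lidFun_le_max_add hP.hPle hs x
  have hr := half_le_rimRadius hs h3
  have ha : topFun s x ≤ -2 * s := by
    unfold topFun; nlinarith [hsq_nonneg x]
  have hb : rimFun s x ≤ -(5 * s / 4) := by
    unfold rimFun; nlinarith [rimRadius_le hs (x 2)]
  have hmax : max (topFun s x) (rimFun s x) ≤ -(5 * s / 4) := max_le (by linarith) hb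
  have hGneg : lidFun P s x < 0 := by linarith
  refine ⟨hGneg, ?_⟩
  have hle := fillFun_le_min hP.hPge hδ (F := F) (s := s) (M := (1 + s) ^ 2 + ε₀ + 2) x (P := P)
  have hw : fillWeight P s δ ((1 + s) ^ 2 + ε₀ + 2) x = 1 + lidFun P s x :=
    fillWeight_eq_of_mem_box hs (by nlinarith) h3 (by linarith)
  have : min (F x) (fillWeight P s δ ((1 + s) ^ 2 + ε₀ + 2) x - 1) ≤ lidFun P s x := by
    rw [hw]; exact (min_le_right _ _).trans (by linarith)
  linarith

/-- On the lateral zone `(1+2s)² ≤ ρ² ≤ (1+3s)²`, `-3s ≤ x₂ ≤ 2s`, both the lid function and the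
filled function are positive. [folklore] -/
theorem pos_of_lateral (hP : Admissible P) (hN : StepNF F E₁ E₂ w₀ η₀ ε₀) (hS : StepScale s δ w₀ η₀) {x : EuclideanSpace ℝ (Fin 3)} (h1 : (1 + 2 * s) ^ 2 ≤ hsq x)
    (h2 : hsq x ≤ (1 + 3 * s) ^ 2) (h3 : -3 * s ≤ x 2) (h4 : x 2 ≤ 2 * s) :
    0 < lidFun P s x ∧ 0 < fillFun F P s δ ((1 + s) ^ 2 + ε₀ + 2) x := by
  obtain ⟨hs, hs1, hsw, hsη, hδ, hδs⟩ := scales hS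
  have hF : F x = hsq x - 1 := F_eq_of_box hN hS h2 (abs_le.2 ⟨by linarith, by linarith⟩)
  have hr1 := rimRadius_le hs (x 2)
  have hr0 := rimRadius_nonneg hs (x 2)
  have hb : 2 * s ≤ rimFun s x := by unfold rimFun; nlinarith
  have hG : 2 * s ≤ lidFun P s x := hb.trans ((le_max_right _ _).trans (max_le_lidFun hP.hPge hs x))
  refine ⟨by linarith, ?_⟩
  have hmin := min_sub_le_fillFun hP.hPle hδ (F := F) (s := s) (M := (1 + s) ^ 2 + ε₀ + 2) x (P := P)
  have hε₀ := hN.hε₀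
  have hw := one_add_lidFun_le_fillWeight hs hδ.le (by positivity : (0:ℝ) ≤ (1 + s) ^ 2 + ε₀ + 2) x
    (P := P) (δ := δ)
  have : 2 * s ≤ min (F x) (fillWeight P s δ ((1 + s) ^ 2 + ε₀ + 2) x - 1) :=
    le_min (by rw [hF]; nlinarith) (by linarith)
  linarith

/-- A zero of the lid function at height `≤ -2s` has `ρ² ≥ 1 - s/8` (it lies on the rim or the
collar, not below the dome). [folklore] -/
theorem hsq_ge_of_lidFun_eq_zero (hP : Admissible P) (hS : StepScale s δ w₀ η₀) {x : EuclideanSpace ℝ (Fin 3)} (hx : lidFun P s x = 0)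
    (h4 : x 2 ≤ -2 * s) : 1 - s / 8 ≤ hsq x := by
  obtain ⟨hs, hs1, -, -, -, -⟩ := scales hS
  have hG := lidFun_le_max_add hP.hPle hs x
  have ha : topFun s x ≤ -2 * s + s * hsq x - s := by unfold topFun; nlinarith
  by_contra hlt
  push Not at hlt
  have ha' : topFun s x < -(s / 8) := by nlinarith [hsq_nonneg x]
  have hr0 := rimRadius_nonneg hs (x 2)
  have hb : rimFun s x < -(s / 8) := by unfold rimFun; nlinarith
  have : max (topFun s x) (rimFun s x) < -(s / 8) := max_lt ha' hb
  linarith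

/-- A zero of the lid function lies in `{ρ² ≤ (1+s)², x₂ ≤ s}`. [folklore] -/
theorem bounds_of_lidFun_eq_zero (hP : Admissible P) (hS : StepScale s δ w₀ η₀) {x : EuclideanSpace ℝ (Fin 3)} (hx : lidFun P s x = 0) :
    x 2 ≤ s ∧ hsq x ≤ (1 + s) ^ 2 :=
  coord_le_and_hsq_le hP.hPge hS.hs hx.le

/-- A zero of the filled function in the closed box has `F ≥ 0` there, hence `ρ² ≥ 1`.
[folklore] -/
theorem one_le_hsq_of_fillFun_eq_zero (hP : Admissible P) (hN : StepNF F E₁ E₂ w₀ η₀ ε₀) (hS : StepScale s δ w₀ η₀) {x : EuclideanSpace ℝ (Fin 3)}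
    (hx : fillFun F P s δ ((1 + s) ^ 2 + ε₀ + 2) x = 0) (hxB : x ∈ closedBox s) : 1 ≤ hsq x := by
  obtain ⟨hs, hs1, hsw, hsη, hδ, hδs⟩ := scales hS
  obtain ⟨h1, h2, h3⟩ := hxB
  have hle := fillFun_le_min hP.hPge hδ (F := F) (s := s) (M := (1 + s) ^ 2 + ε₀ + 2) x (P := P)
  have hF0 : 0 ≤ F x := by
    have : (0 : ℝ) ≤ min (F x) (fillWeight P s δ ((1 + s) ^ 2 + ε₀ + 2) x - 1) := by
      rw [← hx]; exact hle
    exact this.trans (min_le_left _ _)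
  have hF : F x = hsq x - 1 := F_eq_of_box hN hS h1 (abs_le.2 ⟨by linarith, by linarith⟩)
  linarith

/-- **A zero of the filled function in the closed box at height in `[-3s, -5s/2]` lies on the
collar zone** `1 - s/4 ≤ ρ² ≤ (1+2s)²` (so there `F₂ = G`). [folklore] -/
theorem collar_of_fillFun_eq_zero (hP : Admissible P) (hN : StepNF F E₁ E₂ w₀ η₀ ε₀) (hS : StepScale s δ w₀ η₀) {x : EuclideanSpace ℝ (Fin 3)}
    (hx : fillFun F P s δ ((1 + s) ^ 2 + ε₀ + 2) x = 0) (hxB : x ∈ closedBox s)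
    (h3 : -3 * s ≤ x 2) (h4 : x 2 ≤ -2 * s) : 1 - s / 4 ≤ hsq x ∧ hsq x ≤ (1 + 2 * s) ^ 2 := by
  obtain ⟨hs, -, -, -, -, -⟩ := scales hS
  have h1 := one_le_hsq_of_fillFun_eq_zero hP hN hS hx hxB
  refine ⟨by linarith, ?_⟩
  by_contra hgt
  push Not at hgt
  have := (pos_of_lateral hP hN hS hgt.le hxB.1 h3 (by linarith)).2
  linarith

end Zones

/-! ### §3 The sub-sphere as the union of the lid piece, the low piece and the far part of `E₂` -/

section Decomposition

/-- Points of `E₁` in the domain lie in the open box (the rest of `E₁` is the first plug).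
[folklore] -/
theorem mem_openBox_of_mem_left {x : EuclideanSpace ℝ (Fin 3)} (hx : x ∈ E₁)
    (hU : x ∈ subDomain E₁ s (4 * s)) : x ∈ openBox s (4 * s) := by
  rw [mem_subDomain_iff] at hU
  by_contra h
  exact hU.1 ⟨hx, h⟩

/-- **A point of `E₁` in the domain is the circle point `α''`-type: it lies on the upper wall at
height in `[0, 3s/2)`** (points of `E₁` in the open box are wall points at nonnegative height;
those at height `≥ 3s/2` are in the second plug). [folklore] -/
theorem wall_of_mem_left (hN : StepNF F E₁ E₂ w₀ η₀ ε₀) (hS : StepScale s δ w₀ η₀) {x : EuclideanSpace ℝ (Fin 3)} (hx : x ∈ E₁)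
    (hU : x ∈ subDomain E₁ s (4 * s)) : hsq x = 1 ∧ 0 ≤ x 2 ∧ x 2 < 3 * s / 2 := by
  obtain ⟨hs, hs1, hsw, hsη, -, -⟩ := scales hS
  obtain ⟨h1, h2, h3⟩ := mem_openBox_of_mem_left hx hU
  have hbox1 : hsq x ≤ (1 + 3 * w₀) ^ 2 := by nlinarith
  have hbox2 : |x 2| ≤ η₀ := abs_le.2 ⟨by linarith, by linarith⟩
  have hw : hsq x = 1 := hN.hsq_eq_one (hN.eq_zero_of_mem_left hx) hbox1 hbox2
  have hz : 0 ≤ x 2 := hN.hE₁box x hx hbox1 hbox2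
  refine ⟨hw, hz, ?_⟩
  by_contra hge
  push Not at hge
  rw [mem_subDomain_iff] at hU
  exact hU.2 ⟨by nlinarith, hge, h3.le⟩

/-- Points of `E₂` in the closed box are lower wall points. [folklore] -/
theorem wall_of_mem_right (hN : StepNF F E₁ E₂ w₀ η₀ ε₀) (hS : StepScale s δ w₀ η₀) {x : EuclideanSpace ℝ (Fin 3)} (hx : x ∈ E₂) (hxB : x ∈ closedBox s) :
    hsq x = 1 ∧ x 2 ≤ 0 := by
  obtain ⟨hs, hs1, hsw, hsη, -, -⟩ := scales hS
  obtain ⟨h1, h2, h3⟩ := hxB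
  have hbox1 : hsq x ≤ (1 + 3 * w₀) ^ 2 := by nlinarith
  have hbox2 : |x 2| ≤ η₀ := abs_le.2 ⟨by linarith, by linarith⟩
  exact ⟨hN.hsq_eq_one (hN.eq_zero_of_mem_right hx) hbox1 hbox2, hN.hE₂box x hx hbox1 hbox2⟩

/-- **Points of `E₂` outside the closed box are in the domain.** [folklore] -/
theorem mem_subDomain_of_mem_right (hN : StepNF F E₁ E₂ w₀ η₀ ε₀) (hS : StepScale s δ w₀ η₀) {x : EuclideanSpace ℝ (Fin 3)} (hx : x ∈ E₂)
    (hxB : x ∉ closedBox s) : x ∈ subDomain E₁ s (4 * s) := by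
  obtain ⟨hs, hs1, hsw, hsη, -, -⟩ := scales hS
  rw [mem_subDomain_iff]
  constructor
  · -- not in the first plug: a point of `E₁ ∩ E₂` is on the circle, inside the box
    rintro ⟨hx1, -⟩
    obtain ⟨hw, hz⟩ := hN.hE₁₂ ⟨hx1, hx⟩
    exact hxB ⟨by rw [hw]; nlinarith, by rw [hz]; linarith, by rw [hz]; linarith⟩
  · -- not in the second plug: `E₂` in the box lies at heights `≤ 0`
    rintro ⟨h1, h2, h3⟩
    have hbox1 : hsq x ≤ (1 + 3 * w₀) ^ 2 := by nlinarith
    have hbox2 : |x 2| ≤ η₀ := abs_le.2 ⟨by linarith, by linarith⟩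
    have := hN.hE₂box x hx hbox1 hbox2
    linarith

/-- **Outside the closed box the filled function vanishes exactly on `{F = 0}`.** [folklore] -/
theorem fillFun_eq_zero_iff_of_not_mem (hP : Admissible P) (hN : StepNF F E₁ E₂ w₀ η₀ ε₀) (hS : StepScale s δ w₀ η₀) {x : EuclideanSpace ℝ (Fin 3)} (hxB : x ∉ closedBox s) :
    fillFun F P s δ ((1 + s) ^ 2 + ε₀ + 2) x = 0 ↔ F x = 0 := by
  obtain ⟨hs, hs1, hsw, hsη, hδ, hδs⟩ := scales hS
  constructor
  · intro hx
    -- `min(F, w - 1) ≤ δ` and `w - 1 > δ`, so `F ≤ δ ≤ ε₀ + 1`, so `F₂ = F`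
    have hmin := min_sub_le_fillFun hP.hPle hδ (F := F) (s := s) (M := (1 + s) ^ 2 + ε₀ + 2) x (P := P)
    have h1 := fillWeight_ge_of_not_mem hs hδ.le (P := P) (M := (1 + s) ^ 2 + ε₀ + 2)
      (pushCutoff_eq_one_of_not_mem hxB)
    have h2 := neg_sq_le_lidFun hs hP.hPge x (P := P)
    have hε₀ := hN.hε₀
    have hFle : F x ≤ ε₀ + 1 := by
      by_contra hgt
      push Not at hgt
      have : ε₀ + 1 < min (F x) (fillWeight P s δ ((1 + s) ^ 2 + ε₀ + 2) x - 1) :=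
        lt_min hgt (by linarith)
      linarith
    rw [← fillFun_eq_of_not_mem hP.hP0 hP.hPge hs hδ (by linarith) hxB hFle]
    exact hx
  · intro hx
    rw [fillFun_eq_of_not_mem hP.hP0 hP.hPge hs hδ (by linarith) hxB (by rw [hx]; linarith [hN.hε₀])]
    exact hx

/-- **The sub-sphere decomposed**: `W = (lid piece) ∪ (low piece) ∪ (E₂ ∖ closed box)`.
[cite: Schultens2014, proof of Thm. 3.2.5 (PDF p. 45)] -/
theorem subSphere_eq (hP : Admissible P) (hN : StepNF F E₁ E₂ w₀ η₀ ε₀) (hS : StepScale s δ w₀ η₀) :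
    subSphere F P E₁ s δ ε₀ = lidPiece P s ∪ lowPiece F P s δ ε₀ ∪ (E₂ \ closedBox s) := by
  obtain ⟨hs, hs1, hsw, hsη, hδ, hδs⟩ := scales hS
  set M := (1 + s) ^ 2 + ε₀ + 2 with hM
  ext x
  simp only [subSphere, lidPiece, lowPiece, mem_setOf_eq, mem_union, Set.mem_sdiff]
  constructor
  · rintro ⟨hU, hG⟩
    -- case analysis on the position of `x`
    by_cases hxB : x ∈ closedBox s
    · obtain ⟨hb1, hb2, hb3⟩ := hxB
      rw [mem_subDomain_iff] at hU
      -- not in the second plug: `x 2 < 3s/2` (if `ρ² ≤ (1+3s)²`, which holds in the box)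
      have hz : x 2 < 3 * s / 2 := by
        by_contra hge; push Not at hge
        exact hU.2 ⟨hb1, hge, by linarith⟩
      by_cases hz2 : -(5 * s / 2) ≤ x 2
      · -- lid zone or lateral
        by_cases hlat : hsq x ≤ (1 + 2 * s) ^ 2
        · left; left
          have hβ : subFun F P s δ M x = lidFun P s x := subFun_eq_lidFun hs hlat hz2 hz.le
          exact ⟨by rw [← hβ]; exact hG, by linarith⟩
        · exfalso
          push Not at hlat
          obtain ⟨hGp, hFp⟩ := pos_of_lateral hP hN hS hlat.le hb1 (by linarith) (by linarith)
          have := subFun_pos_of_pos hGp hFp (s := s) (δ := δ) (M := M)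
          linarith
      · push Not at hz2
        by_cases hz3 : -3 * s ≤ x 2
        · -- blend heights `[-3s, -5s/2)`: collar, inner or lateral
          by_cases hin : hsq x ≤ 1 - s / 4
          · exfalso
            obtain ⟨hGn, hFn⟩ := neg_of_inner hP hS hin hz3 (by linarith)
            have := subFun_neg_of_neg hGn hFn (s := s) (δ := δ) (M := M)
            linarith
          · push Not at hin
            by_cases hlat : hsq x ≤ (1 + 2 * s) ^ 2
            · -- collar: `F₂ = G`, so `G_B = G = F₂`
              have heq := fillFun_eq_lidFun_of_collar hP hN hS hin.le hlat hz3 (by linarith)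
              have hβ : subFun F P s δ M x = lidFun P s x := subFun_eq_of_eq heq
              left; right
              exact ⟨by rw [heq, ← hβ]; exact hG, hz2.le, ⟨hb1, hb2, hb3⟩⟩
            · exfalso
              push Not at hlat
              obtain ⟨hGp, hFp⟩ := pos_of_lateral hP hN hS hlat.le hb1 hz3 (by linarith)
              have := subFun_pos_of_pos hGp hFp (s := s) (δ := δ) (M := M)
              linarith
        · -- below `-3s`: `G_B = F₂`
          push Not at hz3
          have hβ : subFun F P s δ M x = fillFun F P s δ M x :=
            subFun_eq_fillFun hs (Or.inr (Or.inl hz3.le))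
          left; right
          exact ⟨by rw [← hβ]; exact hG, hz2.le, ⟨hb1, hb2, hb3⟩⟩
    · -- outside the closed box: `G_B = F₂`, whose zeros are those of `F`
      right
      have hβ : subFun F P s δ M x = fillFun F P s δ M x := by
        refine subFun_eq_fillFun hs ?_
        simp only [closedBox, mem_setOf_eq, not_and_or, not_le] at hxB
        rcases hxB with h | h | h
        · exact Or.inl h.le
        · exact Or.inr (Or.inl (by linarith))
        · exact Or.inr (Or.inr (by linarith))
      have hF0 : F x = 0 := (fillFun_eq_zero_iff_of_not_mem hP hN hS hxB).1 (by rw [← hβ]; exact hG)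
      have hxZ : x ∈ E₁ ∪ E₂ := by rw [← hN.hZ]; exact hF0
      rcases hxZ with hx1 | hx2
      · -- a point of `E₁` in the domain lies in the box: contradiction
        exfalso
        obtain ⟨hw, hz0, hz1⟩ := wall_of_mem_left hN hS hx1 hU
        exact hxB ⟨by rw [hw]; nlinarith, by linarith, by linarith⟩
      · exact ⟨hx2, hxB⟩
  · rintro ((⟨hG, hz⟩ | ⟨hF2, hz, hxB⟩) | ⟨hx2, hxB⟩)
    · -- lid piece
      obtain ⟨hzs, hhsq⟩ := bounds_of_lidFun_eq_zero hP hS hG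
      have hhsq2 : hsq x ≤ (1 + 2 * s) ^ 2 := by nlinarith
      have hbox1 : hsq x ≤ (1 + 3 * w₀) ^ 2 := by nlinarith
      have hbox2 : |x 2| ≤ η₀ := abs_le.2 ⟨by linarith, by linarith⟩
      refine ⟨?_, ?_⟩
      · rw [mem_subDomain_iff]
        constructor
        · rintro ⟨hx1, hnot⟩
          have h0 := hN.hE₁box x hx1 hbox1 hbox2
          have hw : hsq x = 1 := hN.hsq_eq_one (hN.eq_zero_of_mem_left hx1) hbox1 hbox2
          -- on the wall above height `0` the lid function is positive; at height `0` the point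
          -- is in the open box, hence not in the plug
          rcases h0.lt_or_eq with hpos | hzero
          · have : 0 < lidFun P s x := lidFun_pos_of_lt_coord hP.hPge hs (by rw [hw]; linarith)
            linarith
          · exact hnot ⟨by rw [hw]; nlinarith, by rw [← hzero]; linarith, by rw [← hzero]; linarith⟩
        · rintro ⟨-, hge, -⟩
          linarith
      · by_cases hz2 : -(5 * s / 2) ≤ x 2
        · rw [subFun_eq_lidFun hs hhsq2 hz2 (by linarith)]; exact hG
        · push Not at hz2
          have h18 := hsq_ge_of_lidFun_eq_zero hP hS hG (by linarith)
          have heq := fillFun_eq_lidFun_of_collar hP hN hS (by linarith) hhsq2 hz (by linarith)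
          rw [subFun_eq_of_eq heq]; exact hG
    · -- low piece
      obtain ⟨hb1, hb2, hb3⟩ := hxB
      refine ⟨?_, ?_⟩
      · rw [mem_subDomain_iff]
        constructor
        · rintro ⟨hx1, -⟩
          have hbox1 : hsq x ≤ (1 + 3 * w₀) ^ 2 := by nlinarith
          have hbox2 : |x 2| ≤ η₀ := abs_le.2 ⟨by linarith, by linarith⟩
          have := hN.hE₁box x hx1 hbox1 hbox2
          linarith
        · rintro ⟨-, hge, -⟩
          linarith
      · by_cases hz3 : -3 * s ≤ x 2
        · obtain ⟨hin, hlat⟩ := collar_of_fillFun_eq_zero hP hN hS hF2 ⟨hb1, hb2, hb3⟩ hz3 (by linarith)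
          have heq := fillFun_eq_lidFun_of_collar hP hN hS hin hlat hz3 (by linarith)
          rw [subFun_eq_of_eq heq, ← heq]; exact hF2
        · push Not at hz3
          rw [subFun_eq_fillFun hs (Or.inr (Or.inl hz3.le))]; exact hF2
    · -- far part of `E₂`
      refine ⟨mem_subDomain_of_mem_right hN hS hx2 hxB, ?_⟩
      have hβ : subFun F P s δ M x = fillFun F P s δ M x := by
        refine subFun_eq_fillFun hs ?_
        simp only [closedBox, mem_setOf_eq, not_and_or, not_le] at hxB
        rcases hxB with h | h | h
        · exact Or.inl h.le
        · exact Or.inr (Or.inl (by linarith))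
        · exact Or.inr (Or.inr (by linarith))
      rw [hβ, fillFun_eq_zero_iff_of_not_mem hP hN hS hxB]
      exact hN.eq_zero_of_mem_right hx2

end Decomposition

/-! ### §4 The sub-sphere is compact -/

section Compact

/-- The far part rewritten with a closed set: `W = lid piece ∪ low piece ∪ (E₂ ∩ Q)`, `Q` the
closed complement-of-the-open-box `{ρ² ≥ (1+3s)²} ∪ {x₂ ≤ -6s} ∪ {x₂ ≥ 3s}` (the only points of
`E₂` on the boundary of the closed box are the wall points at height `-6s`, which are in the low
piece). [folklore] -/
theorem subSphere_eq' (hP : Admissible P) (hN : StepNF F E₁ E₂ w₀ η₀ ε₀) (hS : StepScale s δ w₀ η₀) :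
    subSphere F P E₁ s δ ε₀ = lidPiece P s ∪ lowPiece F P s δ ε₀ ∪
      (E₂ ∩ {x | (1 + 3 * s) ^ 2 ≤ hsq x ∨ x 2 ≤ -6 * s ∨ 3 * s ≤ x 2}) := by
  obtain ⟨hs, hs1, hsw, hsη, hδ, hδs⟩ := scales hS
  rw [subSphere_eq hP hN hS]
  ext x
  simp only [mem_union, Set.mem_sdiff, mem_inter_iff, mem_setOf_eq]
  constructor
  · rintro (h | ⟨hx2, hxB⟩)
    · exact Or.inl h
    · right
      refine ⟨hx2, ?_⟩
      simp only [closedBox, mem_setOf_eq, not_and_or, not_le] at hxB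
      rcases hxB with h | h | h
      · exact Or.inl h.le
      · exact Or.inr (Or.inl h.le)
      · exact Or.inr (Or.inr h.le)
  · rintro (h | ⟨hx2, hQ⟩)
    · exact Or.inl h
    · by_cases hxB : x ∈ closedBox s
      · -- a boundary point of the box in `E₂`: the wall at height `-6s`, in the low piece
        left; right
        obtain ⟨hw, hz⟩ := wall_of_mem_right hN hS hx2 hxB
        obtain ⟨hb1, hb2, hb3⟩ := hxB
        have hz6 : x 2 = -6 * s := by
          rcases hQ with h | h | h
          · nlinarith
          · linarith
          · linarith
        refine ⟨?_, by linarith, ⟨hb1, hb2, hb3⟩⟩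
        -- `F₂ = F = 0` on the lower wall
        have hF0 : F x = 0 := hN.eq_zero_of_mem_right hx2
        have hG : lidFun P s x = hsq x - 1 :=
          lidFun_eq_hsq_sub_one hP.hP1 hs (by linarith) (by linarith) (by rw [hw]; simp; linarith)
        have hw1 : F x ≤ fillWeight P s δ ((1 + s) ^ 2 + ε₀ + 2) x - 1 - δ := by
          have := one_add_lidFun_le_fillWeight hs hδ.le
            (by have := hN.hε₀; positivity : (0:ℝ) ≤ (1 + s) ^ 2 + ε₀ + 2) x (P := P) (δ := δ)
          unfold fillWeight at this ⊢
          rw [collarCutoff_eq_zero hs (by linarith)]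
          have hψ := (pushCutoff_mem_Icc hs x).1
          have hM : (0:ℝ) ≤ (1 + s) ^ 2 + ε₀ + 2 := by have := hN.hε₀; positivity
          rw [hN.hNF x (by nlinarith) (abs_le.2 ⟨by linarith, by linarith⟩)]
          nlinarith [mul_nonneg hM hψ]
        rw [fillFun_eq_left hP.hP0 hδ hw1]
        exact hF0
      · right
        exact ⟨hx2, hxB⟩

/-- The lid piece is closed. [folklore] -/
theorem isClosed_lidPiece (hP : Admissible P) : IsClosed (lidPiece P s) :=
  (isClosed_eq (contDiff_lidFun hP.hP).continuous continuous_const).inter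
    (isClosed_le continuous_const (continuous_coord 2))

/-- The low piece is closed. [folklore] -/
theorem isClosed_lowPiece (hP : Admissible P) (hF : ContDiff ℝ ∞ F) :
    IsClosed (lowPiece F P s δ ε₀) :=
  (isClosed_eq (contDiff_fillFun hF hP.hP).continuous continuous_const).inter
    ((isClosed_le (continuous_coord 2) continuous_const).inter isClosed_closedBox)

/-- **The sub-sphere is compact.** [cite: Schultens2014, proof of Thm. 3.2.5 (PDF p. 45)] -/
theorem isCompact_subSphere (hP : Admissible P) (hN : StepNF F E₁ E₂ w₀ η₀ ε₀)
    (hS : StepScale s δ w₀ η₀) : IsCompact (subSphere F P E₁ s δ ε₀) := by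
  obtain ⟨hs, hs1, hsw, hsη, hδ, hδs⟩ := scales hS
  have hclosed : IsClosed (subSphere F P E₁ s δ ε₀) := by
    rw [subSphere_eq' hP hN hS]
    refine ((isClosed_lidPiece hP).union (isClosed_lowPiece hP hN.hF)).union (hN.hE₂.inter ?_)
    exact (isClosed_le continuous_const continuous_hsq).union
      ((isClosed_le (continuous_coord 2) continuous_const).union
        (isClosed_le continuous_const (continuous_coord 2)))
  -- bounded: inside the compact `{F ≤ ε₀} ∪ closedBox`
  refine (hN.hKε.union (isCompact_closedBox s)).of_isClosed_subset hclosed ?_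
  rw [subSphere_eq hP hN hS]
  rintro x ((⟨hG, hz⟩ | ⟨-, -, hxB⟩) | ⟨hx2, -⟩)
  · right
    obtain ⟨hzs, hhsq⟩ := bounds_of_lidFun_eq_zero hP hS hG
    exact ⟨by nlinarith, by linarith, by linarith⟩
  · exact Or.inr hxB
  · left
    show F x ≤ ε₀
    rw [hN.eq_zero_of_mem_right hx2]
    exact hN.hε₀.le

/-- The sub-sphere lies in `{F₂ = 0} ∪ (lid piece)`; more precisely every point is in the lid
piece, or is a zero of the filled function. [folklore] -/
theorem mem_lidPiece_or_fillFun_eq_zero (hP : Admissible P) (hN : StepNF F E₁ E₂ w₀ η₀ ε₀)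
    (hS : StepScale s δ w₀ η₀) {x : EuclideanSpace ℝ (Fin 3)} (hx : x ∈ subSphere F P E₁ s δ ε₀) :
    x ∈ lidPiece P s ∨ fillFun F P s δ ((1 + s) ^ 2 + ε₀ + 2) x = 0 := by
  rw [subSphere_eq hP hN hS] at hx
  rcases hx with (h | ⟨h, -⟩) | ⟨hx2, hxB⟩
  · exact Or.inl h
  · exact Or.inr h
  · exact Or.inr ((fillFun_eq_zero_iff_of_not_mem hP hN hS hxB).2 (hN.eq_zero_of_mem_right hx2))

end Compact

/-! ### §5 Local form of the sub-sphere function along the sub-sphere; regularity -/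

section Regular

/-- **Near the lid piece the sub-sphere function is the lid function**, as germs: on the open set
`{ρ² < (1+2s)², -3s < x₂ < 3s/2, (-5s/2 < x₂ ∨ 1 - s/4 < ρ²)}`. [folklore] -/
theorem subFun_eventuallyEq_lidFun (hP : Admissible P) (hN : StepNF F E₁ E₂ w₀ η₀ ε₀)
    (hS : StepScale s δ w₀ η₀) {x : EuclideanSpace ℝ (Fin 3)} (h1 : hsq x < (1 + 2 * s) ^ 2)
    (h2 : -3 * s < x 2) (h3 : x 2 < 3 * s / 2) (h4 : -(5 * s / 2) < x 2 ∨ 1 - s / 4 < hsq x) :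
    subFun F P s δ ((1 + s) ^ 2 + ε₀ + 2) =ᶠ[𝓝 x] lidFun P s := by
  obtain ⟨hs, hs1, hsw, hsη, hδ, hδs⟩ := scales hS
  have hopen : IsOpen {y : EuclideanSpace ℝ (Fin 3) | hsq y < (1 + 2 * s) ^ 2 ∧ -3 * s < y 2 ∧
      y 2 < 3 * s / 2 ∧ (-(5 * s / 2) < y 2 ∨ 1 - s / 4 < hsq y)} := by
    refine (isOpen_lt continuous_hsq continuous_const).inter
      ((isOpen_lt continuous_const (continuous_coord 2)).inter
        ((isOpen_lt (continuous_coord 2) continuous_const).inter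
          ((isOpen_lt continuous_const (continuous_coord 2)).union
            (isOpen_lt continuous_const continuous_hsq))))
  filter_upwards [hopen.mem_nhds ⟨h1, h2, h3, h4⟩] with y hy
  obtain ⟨hy1, hy2, hy3, hy4⟩ := hy
  by_cases hz : -(5 * s / 2) ≤ y 2
  · exact subFun_eq_lidFun hs hy1.le hz hy3.le
  · push Not at hz
    have hh : 1 - s / 4 < hsq y := hy4.resolve_left (by linarith)
    exact subFun_eq_of_eq (fillFun_eq_lidFun_of_collar hP hN hS hh.le hy1.le hy2.le (by linarith))

/-- **Away from the lid zone the sub-sphere function is the filled function**, as germs: off the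
closed box, below `x₂ = -3s`, and on the open collar zone
`{1 - s/4 < ρ² < (1+2s)², x₂ < -2s}`. [folklore] -/
theorem subFun_eventuallyEq_fillFun (hP : Admissible P) (hN : StepNF F E₁ E₂ w₀ η₀ ε₀)
    (hS : StepScale s δ w₀ η₀) {x : EuclideanSpace ℝ (Fin 3)}
    (h : x ∉ closedBox s ∨ x 2 < -3 * s ∨ (x 2 < -2 * s ∧ 1 - s / 4 < hsq x ∧ hsq x < (1 + 2 * s) ^ 2)) :
    subFun F P s δ ((1 + s) ^ 2 + ε₀ + 2) =ᶠ[𝓝 x] fillFun F P s δ ((1 + s) ^ 2 + ε₀ + 2) := by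
  obtain ⟨hs, hs1, hsw, hsη, hδ, hδs⟩ := scales hS
  set O : Set (EuclideanSpace ℝ (Fin 3)) := (closedBox s)ᶜ ∪ {y | y 2 < -3 * s} ∪
    {y | y 2 < -2 * s ∧ 1 - s / 4 < hsq y ∧ hsq y < (1 + 2 * s) ^ 2} with hO
  have hopen : IsOpen O := by
    refine (isClosed_closedBox.isOpen_compl.union (isOpen_lt (continuous_coord 2) continuous_const)).union ?_
    exact (isOpen_lt (continuous_coord 2) continuous_const).inter
      ((isOpen_lt continuous_const continuous_hsq).inter (isOpen_lt continuous_hsq continuous_const))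
  have hxO : x ∈ O := by
    rcases h with h | h | h
    · exact Or.inl (Or.inl h)
    · exact Or.inl (Or.inr h)
    · exact Or.inr h
  filter_upwards [hopen.mem_nhds hxO] with y hy
  rcases hy with (hy | hy) | ⟨hy1, hy2, hy3⟩
  · refine subFun_eq_fillFun hs ?_
    simp only [closedBox, mem_compl_iff, mem_setOf_eq, not_and_or, not_le] at hy
    rcases hy with h' | h' | h'
    · exact Or.inl h'.le
    · exact Or.inr (Or.inl (by linarith))
    · exact Or.inr (Or.inr (by linarith))
  · exact subFun_eq_fillFun hs (Or.inr (Or.inl (le_of_lt hy)))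
  · by_cases hz : y 2 ≤ -3 * s
    · exact subFun_eq_fillFun hs (Or.inr (Or.inl hz))
    · push Not at hz
      have heq := fillFun_eq_lidFun_of_collar hP hN hS hy2.le hy3.le hz.le hy1.le
      rw [subFun_eq_of_eq heq, heq]

/-- **The sub-sphere function is regular along the sub-sphere.** [folklore] -/
theorem fderiv_subFun_ne_zero_of_mem (hP : Admissible P) (hN : StepNF F E₁ E₂ w₀ η₀ ε₀)
    (hS : StepScale s δ w₀ η₀) {x : EuclideanSpace ℝ (Fin 3)} (hx : x ∈ subSphere F P E₁ s δ ε₀) :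
    fderiv ℝ (subFun F P s δ ((1 + s) ^ 2 + ε₀ + 2)) x ≠ 0 := by
  obtain ⟨hs, hs1, hsw, hsη, hδ, hδs⟩ := scales hS
  have hregF2 : ∀ y, fillFun F P s δ ((1 + s) ^ 2 + ε₀ + 2) y = 0 →
      fderiv ℝ (fillFun F P s δ ((1 + s) ^ 2 + ε₀ + 2)) y ≠ 0 := fun y hy =>
    fderiv_fillFun_ne_zero hP.hP hP.hP0 hP.hPd hP.hPge hP.hPle hN.hF hN.hε₀ hN.hreg hs hs1 hsw
      (by linarith) hN.hNFa hN.hNFb hδ (by linarith) hy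
  rw [subSphere_eq hP hN hS] at hx
  rcases hx with (⟨hG, hz⟩ | ⟨hF2, hz, hxB⟩) | ⟨hx2, hxB⟩
  · -- lid piece
    obtain ⟨hzs, hhsq⟩ := bounds_of_lidFun_eq_zero hP hS hG
    have hhsq2 : hsq x < (1 + 2 * s) ^ 2 := by nlinarith
    rcases hz.lt_or_eq with hz' | hz'
    · -- `z > -3s`: the germ is the lid function
      have h4 : -(5 * s / 2) < x 2 ∨ 1 - s / 4 < hsq x := by
        by_cases hz5 : -(5 * s / 2) < x 2
        · exact Or.inl hz5
        · push Not at hz5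
          exact Or.inr (by have := hsq_ge_of_lidFun_eq_zero hP hS hG (by linarith); linarith)
      rw [(subFun_eventuallyEq_lidFun hP hN hS hhsq2 hz' (by linarith) h4).fderiv_eq]
      exact fderiv_lidFun_ne_zero hP.hP0 hP.hPle hP.differentiable hP.hPd hs (by linarith) hG
    · -- `z = -3s`: the germ is the filled function, which vanishes here too
      have h18 := hsq_ge_of_lidFun_eq_zero hP hS hG (by linarith)
      have heq := fillFun_eq_lidFun_of_collar hP hN hS (by linarith) hhsq2.le (by linarith)
        (by linarith)
      rw [(subFun_eventuallyEq_fillFun hP hN hS (Or.inr (Or.inr ⟨by linarith, by linarith,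
        hhsq2⟩))).fderiv_eq]
      exact hregF2 x (by rw [heq]; exact hG)
  · -- low piece
    have hcond : x ∉ closedBox s ∨ x 2 < -3 * s ∨
        (x 2 < -2 * s ∧ 1 - s / 4 < hsq x ∧ hsq x < (1 + 2 * s) ^ 2) := by
      by_cases hz3 : x 2 < -3 * s
      · exact Or.inr (Or.inl hz3)
      · push Not at hz3
        obtain ⟨hin, hlat⟩ := collar_of_fillFun_eq_zero hP hN hS hF2 hxB hz3 (by linarith)
        have h1 := one_le_hsq_of_fillFun_eq_zero hP hN hS hF2 hxB
        refine Or.inr (Or.inr ⟨by linarith, by linarith, ?_⟩)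
        rcases hlat.lt_or_eq with hlt | heq
        · exact hlt
        · exfalso
          have := (pos_of_lateral hP hN hS heq.ge hxB.1 hz3 (by linarith)).2
          linarith
    rw [(subFun_eventuallyEq_fillFun hP hN hS hcond).fderiv_eq]
    exact hregF2 x hF2
  · -- far part of `E₂`
    rw [(subFun_eventuallyEq_fillFun hP hN hS (Or.inl hxB)).fderiv_eq]
    exact hregF2 x ((fillFun_eq_zero_iff_of_not_mem hP hN hS hxB).2 (hN.eq_zero_of_mem_right hx2))

end Regular

/-! ### §6 The sub-sphere as a regular level: its manifold structure -/

section Level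

/-- **`0` is a regular level of the sub-sphere function on its domain** (an open subset of
`ℝ³`, a boundaryless manifold): the level is the sub-sphere, along which the function is
regular. [cite: Schultens2014, proof of Thm. 3.2.5 (PDF p. 45)] -/
theorem isRegularLevel_subFun (hP : Admissible P) (hN : StepNF F E₁ E₂ w₀ η₀ ε₀)
    (hS : StepScale s δ w₀ η₀) :
    IsRegularLevel (𝓡 3)
      (fun y : (⟨subDomain E₁ s (4 * s), isOpen_subDomain hN.hE₁⟩ :
        TopologicalSpace.Opens (EuclideanSpace ℝ (Fin 3))) =>
        subFun F P s δ ((1 + s) ^ 2 + ε₀ + 2) y) 0 := by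
  have hGs : ContDiff ℝ ∞ (subFun F P s δ ((1 + s) ^ 2 + ε₀ + 2)) := contDiff_subFun hN.hF hP.hP
  have hG2 : ContDiff ℝ 2 (subFun F P s δ ((1 + s) ^ 2 + ε₀ + 2)) := hGs.of_le (by norm_cast)
  refine ⟨fun y => contMDiffAt_subtype_iff.2 (contMDiff_iff_contDiff.2 hGs).contMDiffAt,
    fun y _ => BoundarylessManifold.isInteriorPoint, fun y hy hyc => ?_⟩
  exact fderiv_subFun_ne_zero_of_mem hP hN hS ⟨y.2, hy⟩
    ((ExpHeight.isMCriticalPt_comp_val_iff hG2 y).1 hyc)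

/-- The level `{f = 0}` of the sub-sphere function on its domain, read in `ℝ³`, is the
sub-sphere. [folklore] -/
theorem image_val_preimage_eq (hN : StepNF F E₁ E₂ w₀ η₀ ε₀) :
    Subtype.val '' ((fun y : (⟨subDomain E₁ s (4 * s), isOpen_subDomain hN.hE₁⟩ :
        TopologicalSpace.Opens (EuclideanSpace ℝ (Fin 3))) =>
        subFun F P s δ ((1 + s) ^ 2 + ε₀ + 2) y) ⁻¹' {0}) = subSphere F P E₁ s δ ε₀ := by
  ext x
  simp only [mem_image, mem_preimage, mem_singleton_iff, Subtype.exists, exists_and_right,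
    exists_eq_right, subSphere, mem_setOf_eq]
  constructor
  · rintro ⟨hx, h⟩
    exact ⟨hx, h⟩
  · rintro ⟨hx, h⟩
    exact ⟨hx, h⟩

end Level

end CappedBallLid

end Literature.Topology.FourManifolds

end
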